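import Summits.HubbardSuperconductivity.HubbardSuperconductivity.Theorems.BirComplexStableXY.Negative.WitnessTable

/-!
# Sketch — crux-ideate round 2, ideator 5, crux `BirComplexStableXYR` (stmt-HubbardSuperconductivity-14845)

Idea `fat-gaussian-defect-calculus`: first checkable statements, as Props over existing
declarations (`BirComplexStableXYNegative.{Table, W, Freq, genF, normA}` of the landed Negative
module `…Theorems.BirComplexStableXY.Negative.WitnessTable`).  Nothing is proved here; the file must
elaborate.

* `CondC`      — the crux's coercivity hypothesis (C), verbatim (as in `Cruxes/BirComplexStableXYR/Disproof.lean`).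
* `capSq`      — the capped square `[|x| ≤ π]·x²` (the part of a pair difference the cosine sees quadratically).
* `FatGaussianDomination` (FIRST LEMMA, elementary, TRUE: `1 − cos x ≥ 2x²/π²` on `[−π,π]`, `≥ 0` elsewhere):
      under (C) alone, for every real `K ≥ 0` and EVERY window configuration `φ`,
      `‖exp(−K·F(φ))‖ ≤ exp(−(2c₀K/π²)·Σ_w Σ_w' capSq(φ_w − φ_w'))`
      — the modulus of each window Boltzmann weight is dominated GLOBALLY by a massless ("fat")
      Gaussian weight; after the lift (all lifted nearest-neighbour differences in `[−π,π]`) this is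
      domination by `exp(−(2c₀K/π²)·E^{nn}_W)`.
* `GaussianDefectCost` (SECOND LEMMA, finite-dimensional linear algebra, TRUE: the eigenvalues of
      `Q^{-1/2} D Q^{-1/2}` number at most `rank D` and lie in `[0, 1−ε]`):
      replacing the thin reference form `Q` by `Q − D` ("fattening" the Gaussian on a defect set whose
      excess form `D` has rank `≤ k` and is `(1−ε)`-subcritical) changes the Gaussian normalisation by at
      most `ε^{−k/2}`:  `ε^k · det Q ≤ det (Q − D)`.  Volume never enters.
-/

set_option linter.dupNamespace false

namespace Summit.HubbardSuperconductivity.HubbardSuperconductivity.Cruxes.BirComplexStableXYR.FatGaussian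

open scoped BigOperators ComplexConjugate Matrix
open Summit.HubbardSuperconductivity.BirComplexStableXYNegative

noncomputable section

/-- (C) coercivity of the real part (verbatim crux hypothesis, named). -/
def CondC {r : ℕ} (c₀ : ℝ) (c : Table r) : Prop :=
  ∀ φ : W r → ℝ, c₀ * ∑ w, ∑ w', (1 - Real.cos (φ w - φ w')) ≤ (genF c φ).re

/-- the capped square: the quadratic lower bound `1 − cos x ≥ (2/π²)·capSq x` holds for all real `x`. -/
def capSq (x : ℝ) : ℝ := if |x| ≤ Real.pi then x ^ 2 else 0

/-- FIRST LEMMA (fat-Gaussian domination of the window modulus weight; uses (C) only). -/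
def FatGaussianDomination : Prop :=
  ∀ (r : ℕ) (c₀ K : ℝ) (c : Table r), 0 ≤ c₀ → 0 ≤ K → CondC c₀ c →
    ∀ φ : W r → ℝ,
      ‖Complex.exp (-((K : ℂ) * genF c φ))‖
        ≤ Real.exp (-(2 * c₀ * K / Real.pi ^ 2) * ∑ w, ∑ w', capSq (φ w - φ w'))

/-- SECOND LEMMA (Gaussian defect cost: fattening the reference Gaussian on a rank-`k`, `(1−ε)`-subcritical
defect form costs at most `ε^{-k/2}` in normalisation — stated as the determinant inequality). -/
def GaussianDefectCost : Prop :=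
  ∀ (ι : Type) [Fintype ι] [DecidableEq ι] (Q D : Matrix ι ι ℝ) (ε : ℝ) (k : ℕ),
    0 < ε → ε ≤ 1 → Q.PosDef → D.PosSemidef → ((1 - ε) • Q - D).PosSemidef → D.rank ≤ k →
      ε ^ k * Q.det ≤ (Q - D).det

/-- The large-field event cost that the two lemmas combine into (informal target of the line's third stub):
under any Gaussian whose form dominates `λ·(window nn-Laplacian)` on the windows of `S'`, the event
"every window of `S'` has oscillation ≥ p" has weight `≤ (C^{|S'|})·exp(−λ p² |S'| / (3r))` relative to the
normalisation — exponential Chebyshev plus `GaussianDefectCost` once more.  Recorded as `True` here. -/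
theorem largeFieldEventCost_informal : True := trivial

end

end Summit.HubbardSuperconductivity.HubbardSuperconductivity.Cruxes.BirComplexStableXYR.FatGaussian
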